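import Literature.MathematicalPhysics.QuantumManyBody.OneCoordinateMarginalRegularity
import Literature.Analysis.Calculus.IntervalCauchySchwarz
import HarnessLib

/-!
# One-coordinate marginals: auxiliary lemmas for the stability of slice data

Topic `Literature/MathematicalPhysics/QuantumManyBody`, grouping namespace `BoseGas`; toolbox for
`OneCoordinateMarginalStability.lean` (the `L¹(dt)`-Lipschitz dependence of the one-coordinate slice
data of `OneCoordinateMarginal.lean` on the wave function in the energy norm), wanted by the crux
`RigidMomentumBound` of route `BECTangentRigidity` (`Summits/AtomisticToContinuum/BoseEinsteinCondensation`).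

* `intervalIntegral_abs_slice_sub_slice_le` : **slice integrals are `L¹`-Lipschitz** — for integrable
  `F, G` on configuration space, `∫ₐᵇ |∫_{x_p=t} F - ∫_{x_p=t} G| dt ≤ ∫ |F - G| dX` (Fubini along the
  coordinate `x_p`; for a.e. `t` both slice functions are integrable);
* `integral_abs_le_sqrt_mul_sqrt_of_param` : the parametrised Cauchy–Schwarz inequality
  `(∀ λ > 0, 2|D| ≤ λq + e/λ a.e.) ⟹ ∫|D| ≤ √∫q · √∫e` (from
  `Literature.Analysis.Calculus.le_sqrt_mul_sqrt_of_forall_pos`), and the pointwise inequalities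
  feeding it (`two_mul_abs_mul_le_param`, `two_mul_abs_sq_sub_sq_le_param`,
  `two_mul_abs_energy_sub_le_param`, `two_mul_abs_sq_sub_sq_le_energy_param`:
  `2||a|² - |b|²| ≤ λ|a-b|² + 2(|a|² + |b|²)/λ` summed over the partial derivatives and the potential term);
* the energy density `|∇ψ|² + V|ψ|²` (`V = ∑_{i<j} v(|xᵢ-xⱼ|) ∈ [0,∞]`, hard cores allowed) as a real
  function: `toReal_kineticDensity_eq_sum`, `toReal_energyDensity_eq` (valid where `V|ψ|² < ∞`, which
  holds a.e. for finite energy: `ae_interaction_mul_normSq_ne_top`), `integral_norm_sq_config_eq_toReal`,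
  `integral_norm_fderiv_sq_le_toReal` (`∫|∂_pψ|² ≤ energy`), and integrability of `|g|²`, `|g||h|` for
  continuous compactly supported `g`.

Everything is standard measure theory / calculus and is tagged folklore.
-/

noncomputable section

namespace Literature.MathematicalPhysics.QuantumManyBody.BoseGas

open _root_.MeasureTheory Filter Set Function
open scoped ENNReal NNReal Topology

variable {N : ℕ}


/-! ### Slice integrals are `L¹`-Lipschitz -/

/-- The pull-back of an integrable function along the slice parametrisation is integrable (for the
product Lebesgue measure on `ℝ × ℝ^{3N-1}`). [folklore] -/
theorem integrable_comp_sliceMap (p : Fin N × Fin 3) {F : Config N → ℝ} (hF : Integrable F) :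
    Integrable (fun z : ℝ × (SliceIdx N p → ℝ) => F (sliceMap p z)) :=
  ((measurePreserving_sliceMap p).integrable_comp_emb (measurableEmbedding_sliceMap p)).2 hF

/-- **Slice integrals are `L¹`-Lipschitz**: for integrable `F, G` on configuration space,
`∫ₐᵇ |∫_{x_p=t} F - ∫_{x_p=t} G| dt ≤ ∫ |F - G| dX`. (For a.e. `t` both slice functions are
integrable, where the difference of the slice integrals is the slice integral of the difference;
then Fubini.) [folklore] -/
theorem intervalIntegral_abs_slice_sub_slice_le (p : Fin N × Fin 3) {F G : Config N → ℝ}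
    (hF : Integrable F) (hG : Integrable G) {a b : ℝ} (hab : a ≤ b) :
    (∫ t in a..b, |(∫ y : SliceIdx N p → ℝ, F (sliceMap p (t, y))) -
        ∫ y : SliceIdx N p → ℝ, G (sliceMap p (t, y))|) ≤ ∫ X, |F X - G X| := by
  have hDabs : Integrable fun X => |F X - G X| := (hF.sub hG).abs
  have haeF : ∀ᵐ t : ℝ, Integrable (fun y : SliceIdx N p → ℝ => F (sliceMap p (t, y))) :=
    (integrable_comp_sliceMap p hF).prod_right_ae
  have haeG : ∀ᵐ t : ℝ, Integrable (fun y : SliceIdx N p → ℝ => G (sliceMap p (t, y))) :=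
    (integrable_comp_sliceMap p hG).prod_right_ae
  have hg : Integrable (fun t : ℝ =>
      ∫ y : SliceIdx N p → ℝ, |F (sliceMap p (t, y)) - G (sliceMap p (t, y))|) :=
    (integrable_comp_sliceMap p hDabs).integral_prod_left
  have hgeq : (∫ t : ℝ, ∫ y : SliceIdx N p → ℝ, |F (sliceMap p (t, y)) - G (sliceMap p (t, y))|) =
      ∫ X, |F X - G X| :=
    (integral_eq_integral_slice p hDabs).symm
  have hpt : ∀ᵐ t : ℝ, |(∫ y : SliceIdx N p → ℝ, F (sliceMap p (t, y))) -
      ∫ y : SliceIdx N p → ℝ, G (sliceMap p (t, y))| ≤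
      ∫ y : SliceIdx N p → ℝ, |F (sliceMap p (t, y)) - G (sliceMap p (t, y))| := by
    filter_upwards [haeF, haeG] with t hFt hGt
    rw [← integral_sub hFt hGt]
    exact abs_integral_le_integral_abs
  rw [intervalIntegral.integral_of_le hab]
  calc (∫ t in Ioc a b, |(∫ y : SliceIdx N p → ℝ, F (sliceMap p (t, y))) -
          ∫ y : SliceIdx N p → ℝ, G (sliceMap p (t, y))|)
      ≤ ∫ t in Ioc a b, ∫ y : SliceIdx N p → ℝ, |F (sliceMap p (t, y)) - G (sliceMap p (t, y))| :=
        integral_mono_of_nonneg (Eventually.of_forall fun t => abs_nonneg _) hg.integrableOn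
          (ae_restrict_of_ae hpt)
    _ ≤ ∫ t, ∫ y : SliceIdx N p → ℝ, |F (sliceMap p (t, y)) - G (sliceMap p (t, y))| :=
        setIntegral_le_integral hg (Eventually.of_forall fun t =>
          integral_nonneg fun y => abs_nonneg _)
    _ = ∫ X, |F X - G X| := hgeq

/-! ### Elementary inequalities -/

/-- AM–GM with a parameter: `2|xy| ≤ λx² + y²/λ` for `λ > 0`. [folklore] -/
theorem two_mul_abs_mul_le_param {x y l : ℝ} (hl : 0 < l) :
    2 * |x * y| ≤ l * x ^ 2 + y ^ 2 / l := by
  rw [abs_mul, ← sq_abs x, ← sq_abs y, ← sub_nonneg]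
  have : l * |x| ^ 2 + |y| ^ 2 / l - 2 * (|x| * |y|) = (l * |x| - |y|) ^ 2 / l := by
    field_simp
    ring
  rw [this]
  positivity

/-- `2|a² - b²| ≤ λc² + 2(a² + b²)/λ` whenever `|a - b| ≤ c`, `a, b ≥ 0`, `λ > 0`
(from `|a² - b²| = |a - b|(a + b)`). [folklore] -/
theorem two_mul_abs_sq_sub_sq_le_param {a b c l : ℝ} (ha : 0 ≤ a) (hb : 0 ≤ b) (hc : |a - b| ≤ c)
    (hl : 0 < l) : 2 * |a ^ 2 - b ^ 2| ≤ l * c ^ 2 + 2 * (a ^ 2 + b ^ 2) / l := by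
  have hab : 0 ≤ a + b := add_nonneg ha hb
  have h1 : |a ^ 2 - b ^ 2| = |a - b| * (a + b) := by
    rw [show a ^ 2 - b ^ 2 = (a - b) * (a + b) by ring, abs_mul, abs_of_nonneg hab]
  have h2 : |a - b| * (a + b) ≤ c * (a + b) := mul_le_mul_of_nonneg_right hc hab
  have h3 : 2 * (c * (a + b)) ≤ l * c ^ 2 + (a + b) ^ 2 / l :=
    (mul_le_mul_of_nonneg_left (le_abs_self _) zero_le_two).trans (two_mul_abs_mul_le_param hl)
  have h4 : (a + b) ^ 2 / l ≤ 2 * (a ^ 2 + b ^ 2) / l :=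
    div_le_div_of_nonneg_right (by nlinarith [sq_nonneg (a - b)]) hl.le
  rw [h1]
  linarith

/-- The pointwise estimate behind the stability of the slice energy: for families `a, b, c ≥ 0` with
`|aᵢ - bᵢ| ≤ cᵢ`, a weight `W ≥ 0` and `|f - g| ≤ d`,
`2|(∑aᵢ² + Wf²) - (∑bᵢ² + Wg²)| ≤ λ(∑cᵢ² + Wd²) + 2((∑aᵢ² + Wf²) + (∑bᵢ² + Wg²))/λ`. [folklore] -/
theorem two_mul_abs_energy_sub_le_param {ι : Type*} (s : Finset ι) {a b c : ι → ℝ}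
    {W f g d l : ℝ} (ha : ∀ i, 0 ≤ a i) (hb : ∀ i, 0 ≤ b i) (hc : ∀ i, |a i - b i| ≤ c i)
    (hW : 0 ≤ W) (hf : 0 ≤ f) (hg : 0 ≤ g) (hd : |f - g| ≤ d) (hl : 0 < l) :
    2 * |((∑ i ∈ s, a i ^ 2) + W * f ^ 2) - ((∑ i ∈ s, b i ^ 2) + W * g ^ 2)| ≤
      l * ((∑ i ∈ s, c i ^ 2) + W * d ^ 2) +
        2 * (((∑ i ∈ s, a i ^ 2) + W * f ^ 2) + ((∑ i ∈ s, b i ^ 2) + W * g ^ 2)) / l := by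
  have hsplit : ((∑ i ∈ s, a i ^ 2) + W * f ^ 2) - ((∑ i ∈ s, b i ^ 2) + W * g ^ 2) =
      (∑ i ∈ s, (a i ^ 2 - b i ^ 2)) + W * (f ^ 2 - g ^ 2) := by
    rw [Finset.sum_sub_distrib]; ring
  have key : 2 * |((∑ i ∈ s, a i ^ 2) + W * f ^ 2) - ((∑ i ∈ s, b i ^ 2) + W * g ^ 2)| ≤
      (∑ i ∈ s, (l * c i ^ 2 + 2 * (a i ^ 2 + b i ^ 2) / l)) +
        W * (l * d ^ 2 + 2 * (f ^ 2 + g ^ 2) / l) := by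
    rw [hsplit]
    calc 2 * |(∑ i ∈ s, (a i ^ 2 - b i ^ 2)) + W * (f ^ 2 - g ^ 2)|
        ≤ 2 * ((∑ i ∈ s, |a i ^ 2 - b i ^ 2|) + W * |f ^ 2 - g ^ 2|) := by
          gcongr
          refine (abs_add_le _ _).trans (add_le_add (Finset.abs_sum_le_sum_abs _ _) ?_)
          rw [abs_mul, abs_of_nonneg hW]
      _ = (∑ i ∈ s, 2 * |a i ^ 2 - b i ^ 2|) + W * (2 * |f ^ 2 - g ^ 2|) := by
          rw [mul_add, Finset.mul_sum]; ring
      _ ≤ (∑ i ∈ s, (l * c i ^ 2 + 2 * (a i ^ 2 + b i ^ 2) / l)) +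
            W * (l * d ^ 2 + 2 * (f ^ 2 + g ^ 2) / l) := by
          gcongr with i _
          · exact two_mul_abs_sq_sub_sq_le_param (ha i) (hb i) (hc i) hl
          · exact two_mul_abs_sq_sub_sq_le_param hf hg hd hl
  have halg : (∑ i ∈ s, (l * c i ^ 2 + 2 * (a i ^ 2 + b i ^ 2) / l)) +
      W * (l * d ^ 2 + 2 * (f ^ 2 + g ^ 2) / l) =
      l * ((∑ i ∈ s, c i ^ 2) + W * d ^ 2) +
        2 * (((∑ i ∈ s, a i ^ 2) + W * f ^ 2) + ((∑ i ∈ s, b i ^ 2) + W * g ^ 2)) / l := by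
    rw [Finset.sum_add_distrib, ← Finset.mul_sum, ← Finset.sum_div, ← Finset.mul_sum,
      Finset.sum_add_distrib]
    field_simp
    ring
  linarith [key, halg]

/-- The single-coordinate version: under the same hypotheses, for `i ∈ s`,
`2|aᵢ² - bᵢ²| ≤ λ(∑cⱼ² + Wd²) + 2((∑aⱼ² + Wf²) + (∑bⱼ² + Wg²))/λ`. [folklore] -/
theorem two_mul_abs_sq_sub_sq_le_energy_param {ι : Type*} (s : Finset ι) {a b c : ι → ℝ}
    {W f g d l : ℝ} (ha : ∀ i, 0 ≤ a i) (hb : ∀ i, 0 ≤ b i) (hc : ∀ i, |a i - b i| ≤ c i)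
    (hW : 0 ≤ W) (hl : 0 < l) {i : ι} (hi : i ∈ s) :
    2 * |a i ^ 2 - b i ^ 2| ≤
      l * ((∑ j ∈ s, c j ^ 2) + W * d ^ 2) +
        2 * (((∑ j ∈ s, a j ^ 2) + W * f ^ 2) + ((∑ j ∈ s, b j ^ 2) + W * g ^ 2)) / l := by
  have h1 := two_mul_abs_sq_sub_sq_le_param (ha i) (hb i) (hc i) hl
  have h2 : c i ^ 2 ≤ (∑ j ∈ s, c j ^ 2) + W * d ^ 2 :=
    (Finset.single_le_sum (f := fun j => c j ^ 2) (fun j _ => sq_nonneg (c j)) hi).trans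
      (le_add_of_nonneg_right (by positivity))
  have h3 : a i ^ 2 + b i ^ 2 ≤
      ((∑ j ∈ s, a j ^ 2) + W * f ^ 2) + ((∑ j ∈ s, b j ^ 2) + W * g ^ 2) :=
    add_le_add
      ((Finset.single_le_sum (f := fun j => a j ^ 2) (fun j _ => sq_nonneg (a j)) hi).trans
        (le_add_of_nonneg_right (by positivity)))
      ((Finset.single_le_sum (f := fun j => b j ^ 2) (fun j _ => sq_nonneg (b j)) hi).trans
        (le_add_of_nonneg_right (by positivity)))
  have h4 : 2 * (a i ^ 2 + b i ^ 2) / l ≤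
      2 * (((∑ j ∈ s, a j ^ 2) + W * f ^ 2) + ((∑ j ∈ s, b j ^ 2) + W * g ^ 2)) / l :=
    div_le_div_of_nonneg_right (by linarith) hl.le
  have h5 : l * c i ^ 2 ≤ l * ((∑ j ∈ s, c j ^ 2) + W * d ^ 2) :=
    mul_le_mul_of_nonneg_left h2 hl.le
  linarith

/-- **Parametrised Cauchy–Schwarz for integrals**: if `2|D| ≤ λq + e/λ` a.e. for every `λ > 0`, with
`q, e ≥ 0` integrable, then `∫|D| ≤ √(∫q) · √(∫e)`. [folklore] -/
theorem integral_abs_le_sqrt_mul_sqrt_of_param {α : Type*} [MeasurableSpace α] {μ : Measure α}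
    {D q e : α → ℝ} (hq : Integrable q μ) (he : Integrable e μ) (hq0 : 0 ≤ᵐ[μ] q)
    (he0 : 0 ≤ᵐ[μ] e) (h : ∀ᵐ x ∂μ, ∀ l : ℝ, 0 < l → 2 * |D x| ≤ l * q x + e x / l) :
    (∫ x, |D x| ∂μ) ≤ Real.sqrt (∫ x, q x ∂μ) * Real.sqrt (∫ x, e x ∂μ) := by
  refine Literature.Analysis.Calculus.le_sqrt_mul_sqrt_of_forall_pos (integral_nonneg_of_ae hq0)
    (integral_nonneg_of_ae he0) fun l hl => ?_
  have hint : Integrable (fun x => (l * q x + e x / l) / 2) μ :=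
    ((hq.const_mul l).add (he.div_const l)).div_const 2
  have hmono : (∫ x, |D x| ∂μ) ≤ ∫ x, (l * q x + e x / l) / 2 ∂μ :=
    integral_mono_of_nonneg (Eventually.of_forall fun x => abs_nonneg _) hint
      (by filter_upwards [h] with x hx; linarith [hx l hl])
  have heq : (∫ x, (l * q x + e x / l) / 2 ∂μ) = (l * (∫ x, q x ∂μ) + (∫ x, e x ∂μ) / l) / 2 := by
    rw [integral_div, integral_add (hq.const_mul l) (he.div_const l), integral_const_mul,
      integral_div]
  linarith [hmono, heq]

/-! ### The energy density as a real function -/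

/-- The kinetic density is finite. [folklore] -/
theorem kineticDensity_ne_top (ψ : Config N → ℂ) (X : Config N) : kineticDensity ψ X ≠ ⊤ :=
  ENNReal.sum_ne_top.2 fun _ _ => ENNReal.sum_ne_top.2 fun _ _ =>
    ENNReal.pow_ne_top ENNReal.coe_ne_top

/-- The real kinetic density as a single sum over the coordinates `q = (i,k)`:
`(|∇ψ|²).toReal = ∑_q |∂_qψ|²`. [folklore] -/
theorem toReal_kineticDensity_eq_sum (ψ : Config N → ℂ) (X : Config N) :
    (kineticDensity ψ X).toReal = ∑ q : Fin N × Fin 3, ‖fderiv ℝ ψ X (unitVec q.1 q.2)‖ ^ 2 := by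
  rw [kineticDensity, ← Fintype.sum_prod_type',
    ENNReal.toReal_sum (fun q _ => ENNReal.pow_ne_top ENNReal.coe_ne_top)]
  refine Finset.sum_congr rfl fun q _ => ?_
  rw [ENNReal.toReal_pow, ENNReal.coe_toReal, coe_nnnorm]

/-- `(V|ψ|²).toReal = V.toReal |ψ|²` (unconditionally: `⊤.toReal = 0`). [folklore] -/
theorem toReal_interaction_mul_normSq (v : ℝ → ℝ≥0∞) (ψ : Config N → ℂ) (X : Config N) :
    (interaction v X * (‖ψ X‖₊ : ℝ≥0∞) ^ 2).toReal = (interaction v X).toReal * ‖ψ X‖ ^ 2 := by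
  rw [ENNReal.toReal_mul, ENNReal.toReal_pow, ENNReal.coe_toReal, coe_nnnorm]

/-- Expansion of the real energy density wherever its potential part is finite:
`(|∇ψ|² + V|ψ|²).toReal = ∑_q |∂_qψ|² + V.toReal |ψ|²`. [folklore] -/
theorem toReal_energyDensity_eq (v : ℝ → ℝ≥0∞) (ψ : Config N → ℂ) (X : Config N)
    (h : interaction v X * (‖ψ X‖₊ : ℝ≥0∞) ^ 2 ≠ ⊤) :
    (kineticDensity ψ X + interaction v X * (‖ψ X‖₊ : ℝ≥0∞) ^ 2).toReal =
      (∑ q : Fin N × Fin 3, ‖fderiv ℝ ψ X (unitVec q.1 q.2)‖ ^ 2) +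
        (interaction v X).toReal * ‖ψ X‖ ^ 2 := by
  rw [ENNReal.toReal_add (kineticDensity_ne_top ψ X) h, toReal_kineticDensity_eq_sum,
    toReal_interaction_mul_normSq]

/-- For a finite-energy function the potential part of the density is a.e. finite. [folklore] -/
theorem ae_interaction_mul_normSq_ne_top {v : ℝ → ℝ≥0∞} (hv : Measurable v) {ψ : Config N → ℂ}
    (hψ : Continuous ψ)
    (hfin : (∫⁻ X, kineticDensity ψ X + interaction v X * (‖ψ X‖₊ : ℝ≥0∞) ^ 2) ≠ ⊤) :
    ∀ᵐ X : Config N, interaction v X * (‖ψ X‖₊ : ℝ≥0∞) ^ 2 ≠ ⊤ := by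
  filter_upwards [ae_lt_top (measurable_energyDensity hv hψ) hfin] with X hX
  exact ne_top_of_le_ne_top hX.ne le_add_self

/-- `∫ |ψ|² = (∫⁻ ‖ψ‖₊²).toReal` for an a.e. strongly measurable `ψ`. [folklore] -/
theorem integral_norm_sq_config_eq_toReal (ψ : Config N → ℂ) (hψ : AEStronglyMeasurable ψ volume) :
    (∫ X, ‖ψ X‖ ^ 2) = (∫⁻ X, (‖ψ X‖₊ : ℝ≥0∞) ^ 2).toReal := by
  rw [integral_eq_lintegral_of_nonneg_ae (Eventually.of_forall fun X => by positivity)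
    (hψ.norm.aemeasurable.pow_const 2).aestronglyMeasurable]
  congr 1
  refine lintegral_congr fun X => ?_
  rw [ENNReal.ofReal_pow (norm_nonneg _), ofReal_norm, enorm_eq_nnnorm]

/-- `∫ |∂_pψ|² ≤ (∫⁻ (|∇ψ|² + V|ψ|²)).toReal` when the right-hand side is finite. [folklore] -/
theorem integral_norm_fderiv_sq_le_toReal (v : ℝ → ℝ≥0∞) (ψ : Config N → ℂ) (p : Fin N × Fin 3)
    (hfin : (∫⁻ X, kineticDensity ψ X + interaction v X * (‖ψ X‖₊ : ℝ≥0∞) ^ 2) ≠ ⊤) :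
    (∫ X, ‖fderiv ℝ ψ X (unitVec p.1 p.2)‖ ^ 2) ≤
      (∫⁻ X, kineticDensity ψ X + interaction v X * (‖ψ X‖₊ : ℝ≥0∞) ^ 2).toReal := by
  rw [integral_norm_sq_config_eq_toReal (fun X => fderiv ℝ ψ X (unitVec p.1 p.2))
    (measurable_fderiv_apply_const ℝ ψ _).aestronglyMeasurable]
  exact ENNReal.toReal_mono hfin (lintegral_mono fun X =>
    (nnnorm_fderiv_sq_le_kineticDensity ψ X p.1 p.2).trans le_self_add)

/-- `|g|²` is integrable for a continuous compactly supported `g`. [folklore] -/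
theorem integrable_norm_sq_of_hasCompactSupport {g : Config N → ℂ} (hg : Continuous g)
    (hs : HasCompactSupport g) : Integrable fun X => ‖g X‖ ^ 2 := by
  have hs' : HasCompactSupport ((fun r : ℝ => r ^ 2) ∘ fun X => ‖g X‖) :=
    hs.norm.comp_left (by simp)
  simp only [Function.comp_def] at hs'
  exact (hg.norm.pow 2).integrable_of_hasCompactSupport hs'

/-- `|g| |h|` is integrable for continuous `g, h` with `g` compactly supported. [folklore] -/
theorem integrable_norm_mul_norm_of_hasCompactSupport {g h : Config N → ℂ} (hg : Continuous g)
    (hh : Continuous h) (hs : HasCompactSupport g) : Integrable fun X => ‖g X‖ * ‖h X‖ := by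
  have hs' : HasCompactSupport ((fun X => ‖g X‖) * fun X => ‖h X‖) := hs.norm.mul_right
  simp only [Pi.mul_def] at hs'
  exact (hg.norm.mul hh.norm).integrable_of_hasCompactSupport hs'

end Literature.MathematicalPhysics.QuantumManyBody.BoseGas

end
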